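import Literature.AlgebraicGeometry.Motives.HodgeThetaSubalgebraUnitaryFifteenSixteenRankTwelve
import Literature.AlgebraicGeometry.Motives.HodgeThetaSubalgebraUnitaryTenNineteenCore
import HarnessLib

/-!
# The `Θ`-subalgebra theorem for unitary multiplicities `(15, 16)`: no constant raising rank `10` — a proper algebra of
# type `(15 | 16)` has a raising operator of rank `4`, `6` or `8` (Ribet 1983 Thm. 3, Lie step; the `p = 31` cell)

Family `hodge`, layer `Literature/AlgebraicGeometry/Motives` (pure linear algebra over `ℂ`; no geometry). Research
context: cell `pub-hodge-ring2` (HONEST FRAMING: research route conditional on HC_CM; not a corollary; Q11.4-sentence-2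
already refuted in dim ≥ 3), Literature lane gen 87, programme R75. UNCONDITIONAL; theorems only, no definition, no
named fact (D-0026), no `sorry`. HONEST SCOPE: a step of the open `(15 | 16)` core, not the core. By
`HodgeThetaSubalgebraUnitaryFifteenSixteenRankTwelve` a proper irreducible unitary `Θ`-subalgebra of type `(15 | 16)`
has maximal raising rank exactly `10` and raising ranks in `{0, 4, 6, 8, 10}`; THIS FILE excludes the constant rank
`10`: some raising operator has rank `4`, `6` or `8`.

THE ARGUMENT. At a rank-`10` raising `B` with all non-zero raising ranks equal to `10`, the Levi types are `(5 | 10)`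
(`L⁺`) and `(10 | 6)` (`L⁻`); a profile `(i, j)` has `i ≤ 5`, `j ≤ 6`, `i + j ∈ {0, 10}`, so is `(0,0)`, `(4,6)` or
`(5,5)`; the last two do not coexist (two pencils give `(5,6)`); some `X₀` moves `U⁺`. If `X₀` has profile `(5,5)`,
both Levi algebras have constant raising rank `5`: `L⁺` (type `(5 | 10)`) is spanned by two raising elements
(`UnitaryConstantRank.exists_fin_span_raise`), the span transfers to `L⁻` (`UnitaryLeviSetup.exists_fin_span_transfer`),
and `L⁻` (irreducible, type `(10 | 6)`, ranks in `{0, 5}`, `10 = 2·5`, `6 ∉ {0, 5}`) refutes it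
(`UnitaryConstantRank.exists_raise_not_mem_span_fin`). If `X₀` has profile `(4,6)`, `L⁻` has constant raising rank
`6` with `(10 − 6) + (6 − 6) < 6`: TOOL F (`UnitaryConstantRank.false_of_le_rank`).

WHAT REMAINS for the `(15 | 16)` core after this file: maximal raising rank `10` with some raising rank in `{4, 6, 8}`
(at the maximal `B`: Levi types `(5 | 10)` / `(10 | 6)`, `i, j ∉ {1, 3}`, profiles among `(0,4)`, `(0,6)`, `(2,2)`,
`(2,4)`, `(2,6)`, `(4,0)`, `(4,2)`, `(4,4)`, `(4,6)`, `(5,5)`, closed under generic maxima, not only `(4,6)`/`(5,5)`).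

## References
* [Ribet1983] K. A. Ribet, *Hodge classes on certain types of abelian varieties*, Amer. J. Math. 105 (1983), Thm. 3.
* [Gordon1997] B. B. Gordon, *A survey of the Hodge conjecture for abelian varieties*, Thm. 6.3 (3), pp. 18–19.
* [Deligne1982HodgeCycles] P. Deligne, *Hodge cycles on abelian varieties*, LNM 900 (1982), I §3 Prop. 3.4, 3.6.
* [GoodmanWallachGTM255] R. Goodman, N. R. Wallach, GTM 255 (2009), §4.1.1.
* [HoffmanKunze1971LinearAlgebra] K. Hoffman, R. Kunze, *Linear Algebra* (1971), §3.1 Thm. 2, §6.7, §8.3.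
-/

noncomputable section

open Module

namespace Literature.AlgebraicGeometry.Motives

namespace HodgeStructure

universe u

variable {W : Type u} [AddCommGroup W] [Module ℂ W]

/-- (G7) **At `(15, 16)` the raising rank is not constantly `10`**: if every raising operator has rank `0` or `10`,
there is no raising operator of rank `10` (see the module docstring: Levi types `(5 | 10)` / `(10 | 6)`, profiles
`(0,0)`, `(4,6)`, `(5,5)`; the raising-space dimension for `k = 2`, resp. TOOL F). [cite: Ribet1983, Thm. 3]
[cite: Gordon1997, Thm. 6.3 (3)] [cite: Deligne1982HodgeCycles, I §3 Prop. 3.4, 3.6] [cite: GoodmanWallachGTM255, §4.1.1]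
[cite: HoffmanKunze1971LinearAlgebra, §3.1 Thm. 2] -/
theorem UnitaryFifteenSixteen.no_constRank_ten [FiniteDimensional ℂ W] {𝔊 : Submodule ℂ (Module.End ℂ W)}
    (hbr : ∀ Y ∈ 𝔊, ∀ Z ∈ 𝔊, Y * Z - Z * Y ∈ 𝔊)
    (hirr : ∀ U : Submodule ℂ W, (∀ A ∈ 𝔊, ∀ u ∈ U, A u ∈ U) → U = ⊥ ∨ U = ⊤)
    {Θ : Module.End ℂ W} (hΘ : Θ ∈ 𝔊) (hΘΘ : Θ * Θ = 1)
    {P Q : Submodule ℂ W} (hP : ∀ x, x ∈ P ↔ Θ x = x) (hQ : ∀ x, x ∈ Q ↔ Θ x = -x)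
    (hP15 : Module.finrank ℂ P = 15) (hQ16 : Module.finrank ℂ Q = 16)
    {s : W → W → ℂ} (hadd : ∀ x y z, s (x + y) z = s x z + s y z)
    (hsymm : ∀ x y, s y x = starRingEnd ℂ (s x y))
    (hPQ : ∀ p ∈ P, ∀ q ∈ Q, s p q = 0) (hdefP : ∀ p ∈ P, s p p = 0 → p = 0) (hdefQ : ∀ q ∈ Q, s q q = 0 → q = 0)
    (hadj : ∀ X ∈ 𝔊, ∃ Y ∈ 𝔊, ∀ x y, s (X x) y = s x (Y y))
    (hS : ∀ B' ∈ 𝔊, Θ * B' = B' → B' * Θ = -B' →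
      Module.finrank ℂ (LinearMap.range B') = 0 ∨ Module.finrank ℂ (LinearMap.range B') = 10)
    {B : Module.End ℂ W} (hB : B ∈ 𝔊) (hΘB : Θ * B = B) (hBΘ : B * Θ = -B)
                    (hr : Module.finrank ℂ (LinearMap.range B) = 10) : False := by
  classical
  have hsU : ∀ U : Submodule ℂ W, ∀ x y z : U, s ((x + y : U) : W) z = s (x : W) z + s (y : W) z :=
    fun U x y z => by simp only [Submodule.coe_add, hadd]
  have hno1 : ∀ B' ∈ 𝔊, Θ * B' = B' → B' * Θ = -B' → Module.finrank ℂ (LinearMap.range B') ≠ 1 := by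
    intro B' hB' hΘB' hB'Θ h1
    rcases hS B' hB' hΘB' hB'Θ with h | h <;> omega
  obtain ⟨ι, Um, Up, PU, QU, Lm, ιm, Pm, Qm, Lp, ιp, Pp, Qp, hιmem, hιι, hιΘ, hιs, hUm, hUp, hfinUm, hfinUp,
    hPM, hQM, hPU, hQU, hrangeP, hPUP, hQUQ, hfinQM, hfinPU, hfinQU, hLm, hLp,
    hιmapply, hPmmem, hQmmem, hbrLm, hirrLm, hιmmem, hιmιm, hPm, hQm, hfinPm, hfinQm, hPmQm, hdefPm, hdefQm, hadjLm,
    hιpapply, hPpmem, hQpmem, hbrLp, hirrLp, hιpmem, hιpιp, hPp, hQp, hfinPp, hfinQp, hPpQp, hdefPp, hdefQp, hadjLp,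
    hsplit⟩ :=
    UnitaryLeviSetup.exists_levi_pair hbr hirr hΘ hΘΘ hP hQ hadd hsymm hPQ hdefP hdefQ hadj hB hΘB hBΘ
  rw [hr] at hfinQM hfinPU hfinQU hfinPm hfinQm hfinPp hfinQp hsplit
  rw [hQ16] at hfinQM hfinQm hfinUm
  rw [hP15] at hfinPU hfinPp hfinUp
  have hcm : ∀ Z : Module.End ℂ W, Z * ι = ι * Z → ∀ x ∈ Um, Z x ∈ Um := fun Z hZ x hx =>
    (hUm _).2 (by rw [← Module.End.mul_apply, ← hZ, Module.End.mul_apply, (hUm x).1 hx, map_neg])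
  have hcp : ∀ Z : Module.End ℂ W, Z * ι = ι * Z → ∀ x ∈ Up, Z x ∈ Up := fun Z hZ x hx =>
    (hUp _).2 (by rw [← Module.End.mul_apply, ← hZ, Module.End.mul_apply, (hUp x).1 hx])
  -- the profiles are `(0, 0)`, `(4, 6)`, `(5, 5)`
  have hprof : ∀ X ∈ 𝔊, Θ * X = X → X * Θ = -X → X * ι = ι * X →
      (Module.finrank ℂ (Up.map X) = 0 ∧ Module.finrank ℂ (Um.map X) = 0) ∨
        (Module.finrank ℂ (Up.map X) = 4 ∧ Module.finrank ℂ (Um.map X) = 6) ∨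
        (Module.finrank ℂ (Up.map X) = 5 ∧ Module.finrank ℂ (Um.map X) = 5) := by
    intro X hX hΘX hXΘ hXc
    obtain ⟨hs, hi, hi', hj, hj'⟩ := hsplit X hΘX hXΘ hXc
    have hr' := hS X hX hΘX hXΘ
    rw [hs] at hr'
    omega
  -- `(4, 6)` and `(5, 5)` do not coexist (two pencils)
  have hnotboth : ∀ X ∈ 𝔊, Θ * X = X → X * Θ = -X → X * ι = ι * X → ∀ X' ∈ 𝔊, Θ * X' = X' → X' * Θ = -X' →
      X' * ι = ι * X' → Module.finrank ℂ (Um.map X) = 6 → Module.finrank ℂ (Up.map X') = 5 → False := by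
    intro X hX hΘX hXΘ hXc X' hX' hΘX' hX'Θ hX'c h6 h5
    obtain ⟨c, hc1, hc2⟩ := UnitaryGenericRank.exists_finrank_le_and_finrank_le (X'.restrict (hcp X' hX'c))
      (X.restrict (hcp X hXc)) (X.restrict (hcm X hXc)) (X'.restrict (hcm X' hX'c))
    obtain ⟨hX₁, hΘX₁, hX₁Θ, hX₁c⟩ := UnitaryLeviSetup.add_smul_raise X hX hΘX hXΘ hXc X' hX' hΘX' hX'Θ hX'c c
    have hi₁ := UnitaryLeviSetup.finrank_map_add_smul hcp X X' hXc hX'c c hX₁c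
    have hj₁ := UnitaryLeviSetup.finrank_map_add_smul hcm X X' hXc hX'c c hX₁c
    have hy' : Module.finrank ℂ (LinearMap.range (X'.restrict (hcp X' hX'c))) = 5 := by
      rw [UnitaryLeviRank.finrank_range_restrict, h5]
    have hx : Module.finrank ℂ (LinearMap.range (X.restrict (hcm X hXc))) = 6 := by
      rw [UnitaryLeviRank.finrank_range_restrict, h6]
    have hp := hprof (X + c • X') hX₁ hΘX₁ hX₁Θ hX₁c
    rw [hi₁, hj₁] at hp
    omega
  -- some `X₀` moves `U⁺`
  obtain ⟨⟨p, hp⟩, hp0⟩ := Module.finrank_pos_iff_exists_ne_zero.1 (show 0 < Module.finrank ℂ PU by omega)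
  obtain ⟨⟨q, hq⟩, hq0⟩ := Module.finrank_pos_iff_exists_ne_zero.1 (show 0 < Module.finrank ℂ QU by omega)
  obtain ⟨X₀, hX₀, hΘX₀, hX₀Θ, hX₀c, c, hιc, hΘc, hX₀c0⟩ :=
    UnitaryLeviFull.exists_raise_commute_apply_ne_zero hbr hirr hΘ hΘΘ hQ hιmem hιι hιΘ hUm hUp
      ⟨p, fun h => hp0 (Subtype.ext h), ((hPU p).1 hp).1, ((hPU p).1 hp).2⟩
      ⟨q, fun h => hq0 (Subtype.ext h), ((hQU q).1 hq).1, ((hQU q).1 hq).2⟩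
  have hmem₀ : X₀ c ∈ Up.map X₀ := Submodule.mem_map_of_mem ((hUp c).2 hιc)
  rcases hprof X₀ hX₀ hΘX₀ hX₀Θ hX₀c with ⟨h0, -⟩ | ⟨hi4, hj6⟩ | ⟨hi5, -⟩
  · rw [Submodule.finrank_eq_zero.1 h0, Submodule.mem_bot] at hmem₀
    exact hX₀c0 hmem₀
  · -- `X₀` has profile `(4, 6)`: `L⁻` (type `(10 | 6)`) has constant raising rank `6` — TOOL F
    obtain ⟨hxmem, hιmx, hxιm, hxrk⟩ := UnitaryLeviSetup.restrict_mem hcm hLm hιmapply X₀ hX₀ hΘX₀ hX₀Θ hX₀c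
    rw [hj6] at hxrk
    refine UnitaryConstantRank.false_of_le_rank hbrLm hirrLm hιmmem hιmιm hPm hQm (s := fun v w : Um => s (v : W) w)
      (hsU Um) (fun v w => hsymm v w) hPmQm hdefPm hdefQm hadjLm hxmem hιmx hxιm (by rw [hxrk]; omega)
      (by rw [hxrk]; omega) fun A hA hιmA hAιm hAne => ?_
    obtain ⟨X, hX, hΘX, hXΘ, hXc, hXUm⟩ :=
      UnitaryLeviSetup.exists_lift hbr hΘ hΘΘ hcm hιΘ hLm hιmapply A hA hιmA hAιm
    have hA0 : Module.finrank ℂ (LinearMap.range A) ≠ 0 := fun h =>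
      hAne (LinearMap.range_eq_bot.1 (Submodule.finrank_eq_zero.1 h))
    rw [hxrk, ← hXUm]
    rcases hprof X hX hΘX hXΘ hXc with ⟨-, h⟩ | ⟨-, h⟩ | ⟨h', -⟩
    · exact (hA0 (hXUm ▸ h)).elim
    · rw [h]
    · exact (hnotboth X₀ hX₀ hΘX₀ hX₀Θ hX₀c X hX hΘX hXΘ hXc hj6 h').elim
  · -- `X₀` has profile `(5, 5)`: BOTH Levi algebras have constant raising rank `5`
    have hSp : ∀ A ∈ Lp, ιp * A = A → A * ιp = -A → A ≠ 0 → Module.finrank ℂ (LinearMap.range A) = 5 := by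
      intro A hA hιpA hAιp hAne
      obtain ⟨X, hX, hΘX, hXΘ, hXc, hXUp⟩ :=
        UnitaryLeviSetup.exists_lift hbr hΘ hΘΘ hcp hιΘ hLp hιpapply A hA hιpA hAιp
      have hA0 : Module.finrank ℂ (LinearMap.range A) ≠ 0 := fun h =>
        hAne (LinearMap.range_eq_bot.1 (Submodule.finrank_eq_zero.1 h))
      rcases hprof X hX hΘX hXΘ hXc with ⟨h, -⟩ | ⟨-, h⟩ | ⟨h, -⟩
      · exact (hA0 (hXUp ▸ h)).elim
      · exact (hnotboth X hX hΘX hXΘ hXc X₀ hX₀ hΘX₀ hX₀Θ hX₀c h hi5).elim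
      · rw [← hXUp, h]
    have hSm : ∀ A ∈ Lm, ιm * A = A → A * ιm = -A →
        Module.finrank ℂ (LinearMap.range A) = 0 ∨ Module.finrank ℂ (LinearMap.range A) = 5 := by
      intro A hA hιmA hAιm
      obtain ⟨X, hX, hΘX, hXΘ, hXc, hXUm⟩ :=
        UnitaryLeviSetup.exists_lift hbr hΘ hΘΘ hcm hιΘ hLm hιmapply A hA hιmA hAιm
      rcases hprof X hX hΘX hXΘ hXc with ⟨-, h⟩ | ⟨-, h'⟩ | ⟨-, h⟩
      · exact Or.inl (hXUm ▸ h)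
      · exact (hnotboth X hX hΘX hXΘ hXc X₀ hX₀ hΘX₀ hX₀Θ hX₀c h' hi5).elim
      · exact Or.inr (hXUm ▸ h)
    have hrule : ∀ X ∈ 𝔊, Θ * X = X → X * Θ = -X → X * ι = ι * X → (∀ v ∈ Up, X v = 0) →
        ∀ u ∈ Um, X u = 0 := by
      intro X hX hΘX hXΘ hXc hXUp u hu
      have hi0 : Module.finrank ℂ (Up.map X) = 0 := by
        rw [Submodule.finrank_eq_zero, Submodule.eq_bot_iff]
        rintro _ ⟨v, hv, rfl⟩
        exact hXUp v hv
      have hj0 : Module.finrank ℂ (Um.map X) = 0 := by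
        rcases hprof X hX hΘX hXΘ hXc with ⟨-, h⟩ | ⟨h, -⟩ | ⟨h, -⟩ <;> omega
      have hmem : X u ∈ Um.map X := Submodule.mem_map_of_mem hu
      rwa [Submodule.finrank_eq_zero.1 hj0, Submodule.mem_bot] at hmem
    obtain ⟨F, hF, hspanF⟩ := UnitaryConstantRank.exists_fin_span_raise 2 hbrLp hirrLp hιpmem hιpιp hPp hQp (r := 5)
      (by norm_num) (by omega) (by omega) (hsU Up) (fun v w => hsymm v w) hPpQp hdefPp hdefQp hadjLp hSp
    obtain ⟨G, hG, hspanG⟩ := UnitaryLeviSetup.exists_fin_span_transfer hbr hΘ hΘΘ hιΘ hUm hUp hLp hLm hιpapply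
      hιmapply hrule hF hspanF
    obtain ⟨A, hA, hιmA, hAιm, hAnot⟩ := UnitaryConstantRank.exists_raise_not_mem_span_fin hbrLm hirrLm hιmmem hιmιm
      hPm hQm (r := 5) (k := 2) (by norm_num) (by norm_num) (by omega) (by omega) (by omega) hSm hG
    exact hAnot (hspanG A hA hιmA hAιm)

/-- **A proper `(15 | 16)` algebra has a raising operator of rank `4`, `6` or `8`.** Under the hypotheses of
`UnitaryFifteenSixteen.eq_top_of_smul_of_maxRank`, if `𝔊 ≠ End(W)` then (besides a raising operator of maximal rank
`10`) some raising operator has rank in `{4, 6, 8}`. [cite: Ribet1983, Thm. 3] [cite: Gordon1997, Thm. 6.3 (3)]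
[cite: Deligne1982HodgeCycles, I §3 Prop. 3.4, 3.6] -/
theorem UnitaryFifteenSixteen.exists_rank_four_six_eight_of_ne_top [FiniteDimensional ℂ W]
    {𝔊 : Submodule ℂ (Module.End ℂ W)}
    (hbr : ∀ Y ∈ 𝔊, ∀ Z ∈ 𝔊, Y * Z - Z * Y ∈ 𝔊)
    (hirr : ∀ U : Submodule ℂ W, (∀ A ∈ 𝔊, ∀ u ∈ U, A u ∈ U) → U = ⊥ ∨ U = ⊤)
    {Θ : Module.End ℂ W} (hΘ : Θ ∈ 𝔊) (hΘΘ : Θ * Θ = 1)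
    {P Q : Submodule ℂ W} (hP : ∀ x, x ∈ P ↔ Θ x = x) (hQ : ∀ x, x ∈ Q ↔ Θ x = -x)
    (hP15 : Module.finrank ℂ P = 15) (hQ16 : Module.finrank ℂ Q = 16)
    {s : W → W → ℂ} (hadd : ∀ x y z, s (x + y) z = s x z + s y z)
    (hsmul : ∀ (c : ℂ) (x y : W), s (c • x) y = c * s x y) (hsymm : ∀ x y, s y x = starRingEnd ℂ (s x y))
    (hPQ : ∀ p ∈ P, ∀ q ∈ Q, s p q = 0) (hdefP : ∀ p ∈ P, s p p = 0 → p = 0) (hdefQ : ∀ q ∈ Q, s q q = 0 → q = 0)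
    (hadj : ∀ X ∈ 𝔊, ∃ Y ∈ 𝔊, ∀ x y, s (X x) y = s x (Y y)) (hne : 𝔊 ≠ ⊤) :
    ∃ B' ∈ 𝔊, Θ * B' = B' ∧ B' * Θ = -B' ∧
      (Module.finrank ℂ (LinearMap.range B') = 4 ∨ Module.finrank ℂ (LinearMap.range B') = 6 ∨
        Module.finrank ℂ (LinearMap.range B') = 8) := by
  obtain ⟨⟨B, hB, hΘB, hBΘ, -, h10⟩, hranks⟩ := UnitaryFifteenSixteen.exists_maxRank_ten_of_ne_top hbr hirr hΘ hΘΘ hP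
    hQ hP15 hQ16 hadd hsmul hsymm hPQ hdefP hdefQ hadj hne
  by_contra hno
  push Not at hno
  refine UnitaryFifteenSixteen.no_constRank_ten hbr hirr hΘ hΘΘ hP hQ hP15 hQ16 hadd hsymm hPQ hdefP hdefQ hadj
    (fun B' hB' hΘB' hB'Θ => ?_) hB hΘB hBΘ h10
  obtain ⟨h4, h6, h8⟩ := hno B' hB' hΘB' hB'Θ
  rcases hranks B' hB' hΘB' hB'Θ with h | h | h | h | h <;> omega

end HodgeStructure

end Literature.AlgebraicGeometry.Motives

end
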